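import Mathlib.Analysis.Complex.Tietze
import Literature.Probability.RandomPlanarGeometry.HullSubdomainAccess
import Literature.Probability.RandomPlanarGeometry.HullRestrictionTests
import Literature.Probability.RandomPlanarGeometry.RestrictionMeasures
import HarnessLib

/-!
# Pulling a chordal curve family back to a law on `Ω` ([LSW] §3, transposition)

Step U3 of the reduction of the uniqueness half `Literature.Probability.RandomPlanarGeometry.LawlerSchrammWerner2003_unique` of

* G. F. Lawler, O. Schramm, W. Werner, *Conformal restriction: the chordal case*, J. Amer.
  Math. Soc. **16** (2003) 917–955, arXiv:math/0209343 (**[LSW]**), p. 5 result 2,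

to the paper's half-plane statements (Prop. 3.3, Lemma 3.2, Thm. 7.3, Cor. 8.6, vendored in
`RestrictionMeasures`). The docstring of `LawlerSchrammWerner2003_unique` says: "pulled back to
`(ℍ; 0, ∞)` by a chordal uniformizing map, each `P D` is a probability measure on `Ω` (Def. 3.1)
which is dilation-invariant … and `𝒜₁`-covariant". This file constructs that pull-back and
proves the transport statements:

* `ConformalEquiv.pullbackTrace φ c = φ⁻¹ (trace c ∩ D)`; for a chordal simple curve class `c`
  of `(D; a, b)` (`chordalCarrier D`) it is a configuration `K ∈ Ω`
  (`mem_restrictionConfigs_pullbackTrace`: relatively closed, connected, `cl K ∩ ℝ = {0}`,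
  unbounded, `ℂ ∖ cl K` connected — Jordan arc separation and Carathéodory) and a simple path
  from `0` to `∞` (`exists_simplePath_pullbackTrace`);
* `pullbackConfig` : `CurveClass ℂ → RestrictionConfig` (junk `imaginaryAxis` off the chordal
  carrier), measurable for the σ-field generated by the avoidance events
  (`measurable_pullbackConfig`), and the **pull-back law** `pullbackLaw P D φ = (P D).map _`
  with `pullbackLaw (avoid A) = P D {c | trace c ∩ φ(A) = ∅}` (`pullbackLaw_avoid`);
* **transport** (`pullbackLaw_eq_of_covariant`): for a conformally covariant family carried by
  chordal simple curves the pull-back law does not depend on `(D, φ)` — the conformal map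
  `ψ ∘ φ⁻¹ : D → D'` has the right boundary values (Carathéodory) and a continuous extension
  to `ℂ` (Tietze), and it intertwines the two pull-backs;
* hence **scale invariance** of the pull-back law (`isScaleInvariant_pullbackLaw`, [LSW]
  Prop. 3.3 (1) "`Γ`-invariant": `φ ∘ (r ·)` is again a chordal uniformizing map).
-/

noncomputable section

open Set Filter Topology Metric MeasureTheory Complex
open UpperHalfPlane (upperHalfPlaneSet isOpen_upperHalfPlaneSet)
open scoped NNReal ENNReal unitInterval Pointwise

namespace Literature.Probability.RandomPlanarGeometry

/-! ### The pulled-back trace of a chordal curve class -/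

namespace ConformalEquiv

variable {D : DobrushinDomain} (φ : ConformalEquiv upperHalfPlaneSet D.carrier)

/-- The **pulled-back trace** `φ⁻¹ (trace c ∩ D) ⊆ ℍ` of a curve class `c` under a uniformizing
map `φ : ℍ → D` ([LSW] Remark 3.8 p. 14: laws on `(O; a, b)` are images of laws on `(ℍ; 0, ∞)`
under a conformal map; transposed). [cite: LawlerSchrammWerner2003Restriction, Remark 3.8 (p. 14), transposed] -/
def pullbackTrace (c : CurveClass ℂ) : Set ℂ := φ.symm '' (c.range ∩ D.carrier)

variable {φ}

/-- The pulled-back trace lies in `ℍ`. [folklore] -/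
theorem pullbackTrace_subset (c : CurveClass ℂ) : φ.pullbackTrace c ⊆ upperHalfPlaneSet := by
  rintro _ ⟨w, hw, rfl⟩
  exact φ.symm_mapsTo hw.2

/-- Membership in the pulled-back trace. [folklore] -/
theorem mem_pullbackTrace_iff {c : CurveClass ℂ} {z : ℂ} :
    z ∈ φ.pullbackTrace c ↔ ∃ w ∈ c.range ∩ D.carrier, φ.symm w = z := Iff.rfl

/-- **Avoidance**: the pulled-back trace avoids `A` iff `φ⁻¹ w ∉ A` for the points `w ∈ D` of
the trace. [folklore] -/
theorem disjoint_pullbackTrace_iff {c : CurveClass ℂ} {A : Set ℂ} :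
    Disjoint (φ.pullbackTrace c) A ↔ ∀ w ∈ c.range ∩ D.carrier, φ.symm w ∉ A := by
  rw [pullbackTrace, Set.disjoint_left]
  constructor
  · intro h w hw hA
    exact h ⟨w, hw, rfl⟩ hA
  · rintro h _ ⟨w, hw, rfl⟩ hA
    exact h w hw hA

end ConformalEquiv

/-! ### Chordal simple curves pull back to configurations of `Ω` -/

section Carrier

variable {D : DobrushinDomain} {φ : ConformalEquiv upperHalfPlaneSet D.carrier}

/-- Unpacking membership in the chordal carrier through a representative. [folklore] -/
theorem exists_rep_of_mem_chordalCarrier {c : CurveClass ℂ} (hc : c ∈ chordalCarrier D) :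
    ∃ γ : Curve ℂ, c = CurveClass.mk γ ∧ γ.IsSimple ∧ γ 0 = D.pt 0 ∧ γ 1 = D.pt 1 ∧
      Set.range γ ⊆ D.carrier ∪ {D.pt 0, D.pt 1} := by
  obtain ⟨⟨⟨⟨γ, hγ, rfl⟩, hs⟩, ht⟩, hr⟩ := hc
  exact ⟨γ, rfl, hγ, hs, ht, hr⟩

/-- The points of the trace of a chordal simple curve inside `D` are the `γ t`, `t ≠ 0, 1`. [folklore] -/
theorem range_inter_carrier_eq {γ : Curve ℂ} (hγ : γ.IsSimple) (h0 : γ 0 = D.pt 0)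
    (h1 : γ 1 = D.pt 1) (hr : Set.range γ ⊆ D.carrier ∪ {D.pt 0, D.pt 1}) :
    Set.range γ ∩ D.carrier = γ '' {t : I | t ≠ 0 ∧ t ≠ 1} := by
  ext w
  constructor
  · rintro ⟨⟨t, rfl⟩, hwD⟩
    refine ⟨t, ⟨?_, ?_⟩, rfl⟩
    · rintro rfl; exact D.pt_notMem_carrier 0 (h0 ▸ hwD)
    · rintro rfl; exact D.pt_notMem_carrier 1 (h1 ▸ hwD)
  · rintro ⟨t, ⟨ht0, ht1⟩, rfl⟩
    exact ⟨⟨t, rfl⟩, apply_mem_carrier_of_chordal hγ h0 h1 hr ht0 ht1⟩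

/-- The parameter set `{t ∈ [0, 1] | t ≠ 0, 1}` is connected. [folklore] -/
theorem isConnected_setOf_ne_zero_ne_one : IsConnected {t : I | t ≠ 0 ∧ t ≠ 1} := by
  have h : {t : I | t ≠ 0 ∧ t ≠ 1} = Set.Ioo (0 : I) 1 := by
    ext t
    simp only [mem_setOf_eq, mem_Ioo]
    constructor
    · rintro ⟨h0, h1⟩
      exact ⟨lt_of_le_of_ne bot_le (Ne.symm h0), lt_of_le_of_ne le_top h1⟩
    · rintro ⟨h0, h1⟩
      exact ⟨h0.ne', h1.ne⟩
  rw [h]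
  refine ⟨⟨⟨1 / 2, by norm_num, by norm_num⟩, ?_, ?_⟩, isPreconnected_Ioo⟩
  · change (0 : I) < ⟨1 / 2, _⟩
    exact Subtype.mk_lt_mk.2 (by norm_num)
  · change (⟨1 / 2, _⟩ : I) < 1
    exact Subtype.mk_lt_mk.2 (by norm_num)

/-- **The inverse ray parametrisation** `[0, ∞) → [0, 1)`, `t ↦ t / (1 + t)`. [folklore] -/
def invRay (t : ℝ≥0) : I :=
  ⟨(t : ℝ) / (1 + t), div_nonneg t.2 (by positivity),
    (div_le_one (by positivity)).2 (by linarith [t.2])⟩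

/-- Value of `invRay`. [folklore] -/
@[simp] theorem coe_invRay (t : ℝ≥0) : (invRay t : ℝ) = (t : ℝ) / (1 + t) := rfl

/-- `invRay 0 = 0`. [folklore] -/
@[simp] theorem invRay_zero : invRay 0 = 0 := by
  ext; simp

/-- `invRay t < 1`. [folklore] -/
theorem invRay_lt_one (t : ℝ≥0) : (invRay t : ℝ) < 1 := by
  rw [coe_invRay, div_lt_one (by positivity)]
  linarith [t.2]

/-- `invRay t ≠ 1`. [folklore] -/
theorem invRay_ne_one (t : ℝ≥0) : invRay t ≠ 1 := fun h ↦ by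
  have := invRay_lt_one t
  rw [h] at this
  exact absurd this (by norm_num)

/-- `invRay t ≠ 0` for `t ≠ 0`. [folklore] -/
theorem invRay_ne_zero {t : ℝ≥0} (ht : t ≠ 0) : invRay t ≠ 0 := fun h ↦ by
  have h' : ((invRay t : ℝ)) = 0 := by rw [h]; rfl
  rw [coe_invRay, div_eq_zero_iff] at h'
  rcases h' with h' | h'
  · exact ht (NNReal.coe_eq_zero.1 h')
  · have := t.coe_nonneg; linarith

/-- `invRay` is continuous. [folklore] -/
theorem continuous_invRay : Continuous invRay := by
  refine Continuous.subtype_mk ?_ _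
  exact NNReal.continuous_coe.div (continuous_const.add NNReal.continuous_coe)
    fun t ↦ by positivity

/-- `invRay` is injective. [folklore] -/
theorem invRay_injective : Function.Injective invRay := by
  intro s t h
  have h' : ((s : ℝ)) / (1 + s) = (t : ℝ) / (1 + t) := by
    have := congrArg (fun u : I ↦ (u : ℝ)) h
    simpa using this
  rw [div_eq_div_iff (by positivity) (by positivity)] at h'
  exact NNReal.coe_injective (by linarith)

/-- `invRay` hits every `s < 1`. [folklore] -/
theorem exists_invRay_eq {s : I} (hs : (s : ℝ) < 1) : ∃ t, invRay t = s := by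
  set t : ℝ≥0 := ⟨(s : ℝ) / (1 - s), div_nonneg s.2.1 (by linarith)⟩ with htdef
  have ht : (t : ℝ) = (s : ℝ) / (1 - s) := rfl
  refine ⟨t, ?_⟩
  ext
  rw [coe_invRay, ht]
  have h1 : (1 : ℝ) - s ≠ 0 := by linarith
  field_simp
  ring

/-- `invRay t → 1` as `t → ∞`. [folklore] -/
theorem tendsto_invRay_atTop : Tendsto (fun t ↦ ((invRay t : ℝ))) atTop (𝓝 1) := by
  have h : (fun t : ℝ≥0 ↦ ((invRay t : ℝ))) = fun t : ℝ≥0 ↦ 1 - (1 + (t : ℝ))⁻¹ := by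
    funext t
    rw [coe_invRay]
    have : (1 : ℝ) + t ≠ 0 := by positivity
    field_simp
    ring
  rw [h]
  have h2 : Tendsto (fun t : ℝ≥0 ↦ 1 + (t : ℝ)) atTop atTop :=
    tendsto_atTop_add_const_left _ _ (NNReal.tendsto_coe_atTop.2 tendsto_id)
  have h3 := (tendsto_const_nhds (x := (1 : ℝ))).sub h2.inv_tendsto_atTop
  rwa [sub_zero] at h3

/-- **The pulled-back trace of a chordal simple curve is a simple path from `0` to `∞`**:
`t ↦ φ⁻¹ (γ (t / (1 + t)))` (value `0` at `t = 0`) is continuous (Carathéodory: `φ⁻¹ → 0` at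
`a`), injective, tends to `∞` (`φ⁻¹ → ∞` at `b`), has positive imaginary part for `t > 0`, and
its image of `(0, ∞)` is the pulled-back trace. [folklore] -/
theorem exists_simplePath_pullbackTrace (hC : JordanDomain.exists_continuousOn_extension)
    (hφ : D.IsChordalUniformizing φ) {c : CurveClass ℂ} (hc : c ∈ chordalCarrier D) :
    ∃ β : ℝ≥0 → ℂ, Continuous β ∧ Function.Injective β ∧ β 0 = 0 ∧
      (∀ t, 0 < t → 0 < (β t).im) ∧ Tendsto (fun t ↦ ‖β t‖) atTop atTop ∧
      φ.pullbackTrace c = β '' Ioi 0 := by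
  classical
  obtain ⟨γ, rfl, hγ, h0, h1, hr⟩ := exists_rep_of_mem_chordalCarrier hc
  obtain ⟨Ψ, hΨc, hΨeq, hbij, -⟩ := hC D.toJordanDomain (cayley.symm.trans φ)
  have hinj : InjOn Ψ (closedBall 0 1) := hbij.injOn
  have hmemD : ∀ {t : ℝ≥0}, t ≠ 0 → γ (invRay t) ∈ D.carrier := fun ht ↦
    apply_mem_carrier_of_chordal hγ h0 h1 hr (invRay_ne_zero ht) (invRay_ne_one _)
  set β : ℝ≥0 → ℂ := fun t ↦ if t = 0 then 0 else φ.symm (γ (invRay t)) with hβ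
  have hβ0 : β 0 = 0 := if_pos rfl
  have hβpos : ∀ {t : ℝ≥0}, t ≠ 0 → β t = φ.symm (γ (invRay t)) := fun ht ↦ if_neg ht
  have hβH : ∀ {t : ℝ≥0}, t ≠ 0 → β t ∈ upperHalfPlaneSet := fun ht ↦ by
    rw [hβpos ht]; exact φ.symm_mapsTo (hmemD ht)
  have hγc : Continuous fun t : ℝ≥0 ↦ γ (invRay t) := γ.continuous.comp continuous_invRay
  refine ⟨β, ?_, ?_, hβ0, fun t ht ↦ hβH ht.ne', ?_, ?_⟩
  · -- continuity: off `0` by composition, at `0` by `φ⁻¹ → 0` at `a`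
    rw [continuous_iff_continuousAt]
    intro t
    rcases eq_or_ne t 0 with rfl | ht
    · have hlim : Tendsto (fun t : ℝ≥0 ↦ φ.symm (γ (invRay t))) (𝓝[≠] 0) (𝓝 0) := by
        have h2 : Tendsto φ.symm (𝓝[D.carrier] (D.pt 0)) (𝓝 ((0 : ℝ) : ℂ)) :=
          JordanDomain.tendsto_symm_nhds φ hΨc hΨeq hinj (x := 0) (by exact_mod_cast hφ.1)
        rw [ofReal_zero] at h2
        refine h2.comp (tendsto_nhdsWithin_iff.2 ⟨?_, ?_⟩)
        · have := hγc.tendsto 0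
          rw [invRay_zero, h0] at this
          exact this.mono_left nhdsWithin_le_nhds
        · exact eventually_nhdsWithin_of_forall fun t ht ↦ hmemD ht
      rw [← continuousWithinAt_compl_self, ContinuousWithinAt, hβ0]
      exact hlim.congr' (eventually_nhdsWithin_of_forall fun t ht ↦ (hβpos ht).symm)
    · have hev : β =ᶠ[𝓝 t] fun t ↦ φ.symm (γ (invRay t)) := by
        filter_upwards [isOpen_ne.mem_nhds ht] with s hs
        exact hβpos hs
      rw [ContinuousAt, Filter.tendsto_congr' hev, hβpos ht]
      exact ((φ.symm.continuousOn.continuousAt (D.isOpen.mem_nhds (hmemD ht))).tendsto).comp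
        (hγc.tendsto t)
  · -- injectivity
    intro s t hst
    rcases eq_or_ne s 0 with rfl | hs <;> rcases eq_or_ne t 0 with rfl | ht
    · rfl
    · exfalso
      rw [hβ0] at hst
      have h := hβH ht
      rw [← hst] at h
      exact absurd h (by simp [upperHalfPlaneSet])
    · exfalso
      rw [hβ0] at hst
      have h := hβH hs
      rw [hst] at h
      exact absurd h (by simp [upperHalfPlaneSet])
    · rw [hβpos hs, hβpos ht] at hst
      have h1 : γ (invRay s) = γ (invRay t) := by
        have := congrArg φ hst
        rwa [φ.apply_symm_apply (hmemD hs), φ.apply_symm_apply (hmemD ht)] at this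
      exact invRay_injective (hγ h1)
  · -- transience: `φ⁻¹ → ∞` at `b`
    have h1 : Tendsto (fun t : ℝ≥0 ↦ γ (invRay t)) atTop (𝓝[D.carrier] (D.pt 1)) := by
      refine tendsto_nhdsWithin_iff.2 ⟨?_, ?_⟩
      · have hI : Tendsto invRay atTop (𝓝 (1 : I)) := by
          rw [tendsto_subtype_rng]
          exact tendsto_invRay_atTop
        have := (γ.continuous.tendsto 1).comp hI
        rwa [h1] at this
      · filter_upwards [Filter.eventually_ne_atTop 0] with t ht
        exact hmemD ht
    have h2 := (tendsto_norm_cocompact_atTop.comp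
      ((JordanDomain.tendsto_symm_cocompact φ hΨc hΨeq hinj hφ.2).comp h1))
    refine h2.congr' ?_
    filter_upwards [Filter.eventually_ne_atTop 0] with t ht
    simp only [Function.comp_apply]
    rw [hβpos ht]
  · -- the image of `(0, ∞)`
    rw [ConformalEquiv.pullbackTrace, CurveClass.range_mk,
      show (γ.range : Set ℂ) = Set.range γ from rfl, range_inter_carrier_eq hγ h0 h1 hr]
    ext z
    constructor
    · rintro ⟨_, ⟨u, ⟨hu0, hu1⟩, rfl⟩, rfl⟩
      have hu : (u : ℝ) < 1 := lt_of_le_of_ne u.2.2 fun h ↦ hu1 (Subtype.ext h)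
      obtain ⟨t, rfl⟩ := exists_invRay_eq hu
      have ht : t ≠ 0 := by rintro rfl; exact hu0 invRay_zero
      exact ⟨t, pos_iff_ne_zero.2 ht, hβpos ht⟩
    · rintro ⟨t, ht, rfl⟩
      have ht' : t ≠ 0 := (pos_iff_ne_zero.1 ht)
      exact ⟨γ (invRay t), ⟨invRay t, ⟨invRay_ne_zero ht', invRay_ne_one t⟩, rfl⟩, (hβpos ht').symm⟩

/-- For a chordal simple curve the pulled-back trace is the set `K ∖ {0}` of
`pullback_trace_spec`. [folklore] -/
theorem pullbackTrace_mk_eq {γ : Curve ℂ} (hγ : γ.IsSimple) (h0 : γ 0 = D.pt 0)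
    (h1 : γ 1 = D.pt 1) (hr : Set.range γ ⊆ D.carrier ∪ {D.pt 0, D.pt 1}) :
    φ.pullbackTrace (CurveClass.mk γ) = φ.symm '' (γ '' {t : I | t ≠ 0 ∧ t ≠ 1}) := by
  rw [ConformalEquiv.pullbackTrace, CurveClass.range_mk, show (γ.range : Set ℂ) = Set.range γ from rfl,
    range_inter_carrier_eq hγ h0 h1 hr]

/-- **Chordal simple curves pull back to configurations of `Ω`** ([LSW] Def. 3.1: "A simple
example of a set `K ∈ Ω` is a simple curve `γ` from `0` to infinity in the upper half-plane"):
for `c ∈ chordalCarrier D` the pulled-back trace is relatively closed in `ℍ`, connected, its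
closure meets `ℝ` exactly at `0`, it is unbounded, and the complement of its closure is
connected (Jordan arc separation `hJarc` and Carathéodory `hC`, via `pullback_trace_spec`).
[cite: LawlerSchrammWerner2003Restriction, Def. 3.1 (p. 10), transposed] -/
theorem mem_restrictionConfigs_pullbackTrace (hJarc : Literature.Topology.PlaneTopology.JordanArcSeparation)
    (hC : JordanDomain.exists_continuousOn_extension) (hφ : D.IsChordalUniformizing φ)
    {c : CurveClass ℂ} (hc : c ∈ chordalCarrier D) : φ.pullbackTrace c ∈ restrictionConfigs := by
  obtain ⟨β, hβc, -, hβ0, hβH, hβinf, hβeq⟩ := exists_simplePath_pullbackTrace hC hφ hc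
  obtain ⟨γ, rfl, hγ, h0, h1, hr⟩ := exists_rep_of_mem_chordalCarrier hc
  obtain ⟨K, hKcl, hKc, -, hKsub, hKmem, hKrep⟩ := pullback_trace_spec hJarc hC hφ hγ h0 h1 hr
  set pT := φ.pullbackTrace (CurveClass.mk γ) with hpTdef
  have hpTH : pT ⊆ upperHalfPlaneSet := ConformalEquiv.pullbackTrace_subset _
  have h0pT : (0 : ℂ) ∉ pT := fun h ↦ absurd (hpTH h) (by simp [upperHalfPlaneSet])
  -- `pT = K ∖ {0}`
  have hpTK : pT ⊆ K := by
    rw [hpTdef, pullbackTrace_mk_eq hγ h0 h1 hr]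
    rintro _ ⟨_, ⟨t, ⟨ht0, ht1⟩, rfl⟩, rfl⟩
    exact hKmem t ht0 ht1
  have hKpT : K ⊆ pT ∪ {0} := by
    intro z hz
    rcases eq_or_ne z 0 with rfl | hz0
    · exact Or.inr rfl
    · obtain ⟨t, ht0, ht1, rfl⟩ := hKrep z hz hz0
      left
      rw [hpTdef, pullbackTrace_mk_eq hγ h0 h1 hr]
      exact ⟨γ t, ⟨t, ⟨ht0, ht1⟩, rfl⟩, rfl⟩
  have hclK : closure pT ⊆ K := closure_minimal hpTK hKcl
  -- `0 ∈ closure pT`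
  have h0cl : (0 : ℂ) ∈ closure pT := by
    rw [hβeq, ← hβ0]
    refine image_closure_subset_closure_image hβc ⟨0, ?_, rfl⟩
    rw [closure_Ioi]
    exact self_mem_Ici
  have hcl : closure pT = K := by
    refine hclK.antisymm fun z hz ↦ ?_
    rcases hKpT hz with h | h
    · exact subset_closure h
    · rw [mem_singleton_iff.1 h]; exact h0cl
  refine ⟨?_, ?_, ?_, ?_, ?_⟩
  · -- relatively closed in `ℍ`
    refine Subset.antisymm ?_ fun z hz ↦ ⟨subset_closure hz, hpTH hz⟩
    rintro z ⟨hzcl, hzH⟩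
    rcases hKpT (hclK hzcl) with h | h
    · exact h
    · exact absurd hzH (by rw [mem_singleton_iff.1 h]; simp [upperHalfPlaneSet])
  · -- connected
    rw [hpTdef, pullbackTrace_mk_eq hγ h0 h1 hr]
    refine (isConnected_setOf_ne_zero_ne_one.image _ γ.continuous.continuousOn).image _
      (φ.symm.continuousOn.mono ?_)
    rintro _ ⟨t, ⟨ht0, ht1⟩, rfl⟩
    exact apply_mem_carrier_of_chordal hγ h0 h1 hr ht0 ht1
  · -- `closure ∩ ℝ = {0}`
    refine Subset.antisymm ?_ ?_
    · rintro z ⟨hzcl, ⟨x, rfl⟩⟩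
      rcases hKsub (hclK hzcl) with h | h
      · exact absurd h (by simp [upperHalfPlaneSet])
      · exact h
    · rintro z (rfl : z = 0)
      exact ⟨h0cl, ⟨0, ofReal_zero⟩⟩
  · -- unbounded
    intro hb
    obtain ⟨R, hR⟩ := hb.subset_closedBall 0
    have hev := (hβinf.eventually_gt_atTop R).and (Filter.eventually_gt_atTop 0)
    obtain ⟨t, ht, ht0⟩ := hev.exists
    have hmem : β t ∈ pT := by rw [hβeq]; exact ⟨t, ht0, rfl⟩
    have := hR hmem
    rw [mem_closedBall, dist_zero_right] at this
    linarith
  · -- complement of the closure connected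
    rw [hcl]; exact hKc

end Carrier

/-! ### The pull-back configuration map -/

section Config

variable {D : DobrushinDomain} {φ : ConformalEquiv upperHalfPlaneSet D.carrier}
  {hJarc : Literature.Topology.PlaneTopology.JordanArcSeparation} {hC : JordanDomain.exists_continuousOn_extension}
  {hφ : D.IsChordalUniformizing φ}

open Classical in
/-- The **pull-back configuration** of a curve class: the configuration `φ⁻¹ (trace c ∩ D) ∈ Ω`
for a chordal simple curve class `c` of `(D; a, b)`, and the junk value `i (0, ∞)` otherwise
([LSW] Remark 3.8: the image of `P_α` "under a conformal map from `ℍ` to `O` that takes `a` to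
`0` and `b` to `∞`"; here the inverse direction). [cite: LawlerSchrammWerner2003Restriction, Remark 3.8 (p. 14), transposed] -/
def pullbackConfig (hJarc : Literature.Topology.PlaneTopology.JordanArcSeparation) (hC : JordanDomain.exists_continuousOn_extension)
    (hφ : D.IsChordalUniformizing φ) (c : CurveClass ℂ) : RestrictionConfig :=
  if h : c ∈ chordalCarrier D then ⟨φ.pullbackTrace c, mem_restrictionConfigs_pullbackTrace hJarc hC hφ h⟩
  else RestrictionConfig.imaginaryAxis

/-- On the chordal carrier the pull-back configuration is the pulled-back trace. [folklore] -/
theorem coe_pullbackConfig {c : CurveClass ℂ} (hc : c ∈ chordalCarrier D) :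
    ((pullbackConfig hJarc hC hφ c : RestrictionConfig) : Set ℂ) = φ.pullbackTrace c := by
  rw [pullbackConfig, dif_pos hc]

/-- Off the chordal carrier the pull-back configuration is the junk value. [folklore] -/
theorem pullbackConfig_of_not_mem {c : CurveClass ℂ} (hc : c ∉ chordalCarrier D) :
    pullbackConfig hJarc hC hφ c = RestrictionConfig.imaginaryAxis := by
  rw [pullbackConfig, dif_neg hc]

/-- Avoidance events pull back to avoidance of the pulled-back trace (on the carrier). [folklore] -/
theorem pullbackConfig_mem_avoid_iff {c : CurveClass ℂ} (hc : c ∈ chordalCarrier D) {A : Set ℂ} :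
    pullbackConfig hJarc hC hφ c ∈ RestrictionConfig.avoid A ↔ Disjoint (φ.pullbackTrace c) A := by
  rw [RestrictionConfig.mem_avoid, coe_pullbackConfig hc]

/-- **Avoidance of `A` by the pulled-back trace is avoidance of `φ(A)` by the trace**: for
`A ⊆ ℍ̄` with `0 ∉ A` and `c` in the chordal carrier (boundary correspondence,
`MarkedDomain.disjoint_image_boundaryExtension_iff`). [folklore] -/
theorem disjoint_pullbackTrace_iff_mem_rangeSubset (hC : JordanDomain.exists_continuousOn_extension)
    (hφ : D.IsChordalUniformizing φ) {c : CurveClass ℂ} (hc : c ∈ chordalCarrier D) {A : Set ℂ}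
    (hA : A ⊆ closure upperHalfPlaneSet) (h0 : (0 : ℂ) ∉ A) :
    Disjoint (φ.pullbackTrace c) A ↔
      c ∈ CurveClass.rangeSubset (φ.boundaryExtension '' A)ᶜ := by
  rw [CurveClass.mem_rangeSubset, subset_compl_iff_disjoint_right,
    MarkedDomain.disjoint_image_boundaryExtension_iff hC hφ hA h0 hc.2,
    ConformalEquiv.disjoint_pullbackTrace_iff]

/-- **The preimage of an avoidance event.** For `A ⊆ ℍ̄` compact with `0 ∉ A`, the pull-back
configuration avoids `A` exactly on
`(carrier ∩ {trace ∩ φ(A) = ∅}) ∪ (carrierᶜ ∩ [i(0,∞) ∩ A = ∅])`. [folklore] -/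
theorem preimage_pullbackConfig_avoid {A : Set ℂ} (hA : A ⊆ closure upperHalfPlaneSet)
    (h0 : (0 : ℂ) ∉ A) :
    pullbackConfig hJarc hC hφ ⁻¹' RestrictionConfig.avoid A =
      (chordalCarrier D ∩ CurveClass.rangeSubset (φ.boundaryExtension '' A)ᶜ) ∪
        ((chordalCarrier D)ᶜ ∩
          {_c | Disjoint ((RestrictionConfig.imaginaryAxis : RestrictionConfig) : Set ℂ) A}) := by
  ext c
  by_cases hc : c ∈ chordalCarrier D
  · rw [mem_preimage, pullbackConfig_mem_avoid_iff hc,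
      disjoint_pullbackTrace_iff_mem_rangeSubset hC hφ hc hA h0]
    simp [hc]
  · rw [mem_preimage, pullbackConfig_of_not_mem hc, RestrictionConfig.mem_avoid]
    simp [hc]

/-- **The pull-back configuration map is measurable** for the σ-field of [LSW] §3 generated by
the avoidance events of `*`-hulls. [folklore] -/
theorem measurable_pullbackConfig : Measurable (pullbackConfig hJarc hC hφ) := by
  refine measurable_generateFrom ?_
  rintro _ ⟨A, hA, rfl⟩
  rw [preimage_pullbackConfig_avoid hA.1.subset_closure hA.2]
  refine (measurableSet_chordalCarrier.inter (CurveClass.measurableSet_rangeSubset_compl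
    (MarkedDomain.isCompact_image_boundaryExtension hC hA.1.subset_closure
      hA.1.isCompact).isClosed)).union
    (measurableSet_chordalCarrier.compl.inter (MeasurableSet.const _))

/-- **Every pull-back configuration is a simple path from `0` to `∞`** (surely, not only
almost surely): on the chordal carrier by `exists_simplePath_pullbackTrace`, and the junk value
`i(0, ∞)` is one too. [folklore] -/
theorem isSimplePath_pullbackConfig (c : CurveClass ℂ) : (pullbackConfig hJarc hC hφ c).IsSimplePath := by
  by_cases hc : c ∈ chordalCarrier D
  · obtain ⟨β, hβc, hβi, hβ0, -, hβinf, hβeq⟩ := exists_simplePath_pullbackTrace hC hφ hc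
    exact ⟨β, hβc, hβi, hβ0, hβinf, by rw [coe_pullbackConfig hc, hβeq]⟩
  · rw [pullbackConfig_of_not_mem hc]
    exact RestrictionConfig.isSimplePath_imaginaryAxis

end Config

/-! ### The pull-back law on `Ω` -/

namespace ChordalFamily

variable {D : DobrushinDomain} {φ : ConformalEquiv upperHalfPlaneSet D.carrier}
  {hJarc : Literature.Topology.PlaneTopology.JordanArcSeparation} {hC : JordanDomain.exists_continuousOn_extension}
  {hφ : D.IsChordalUniformizing φ}

/-- **The pull-back law** of the chordal family `P` in `(D; a, b)` through the chordal
uniformizing map `φ`: the law on `Ω` of `φ⁻¹ (trace ∩ D)` under `P D` ([LSW] §3 with Remark 3.8: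
the paper's `P` on `Ω` versus its image in `(O; a, b)`; transposed, inverse direction).
[cite: LawlerSchrammWerner2003Restriction, §3 p. 10 and Remark 3.8 (p. 14), transposed] -/
def pullbackLaw (P : ChordalFamily) (D : DobrushinDomain)
    (φ : ConformalEquiv upperHalfPlaneSet D.carrier) (hJarc : Literature.Topology.PlaneTopology.JordanArcSeparation)
    (hC : JordanDomain.exists_continuousOn_extension) (hφ : D.IsChordalUniformizing φ) :
    Measure RestrictionConfig :=
  (P D).map (pullbackConfig hJarc hC hφ)

/-- The pull-back law of a measurable event. [folklore] -/
theorem pullbackLaw_apply (P : ChordalFamily) {S : Set RestrictionConfig} (hS : MeasurableSet S) :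
    pullbackLaw P D φ hJarc hC hφ S = P D (pullbackConfig hJarc hC hφ ⁻¹' S) :=
  Measure.map_apply measurable_pullbackConfig hS

/-- The pull-back law of a probability measure is a probability measure. [folklore] -/
instance isProbabilityMeasure_pullbackLaw (P : ChordalFamily) [IsProbabilityMeasure (P D)] :
    IsProbabilityMeasure (pullbackLaw P D φ hJarc hC hφ) :=
  Measure.isProbabilityMeasure_map measurable_pullbackConfig.aemeasurable

/-- The pull-back law of a finite measure is finite. [folklore] -/
instance isFiniteMeasure_pullbackLaw (P : ChordalFamily) [IsFiniteMeasure (P D)] :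
    IsFiniteMeasure (pullbackLaw P D φ hJarc hC hφ) :=
  Measure.isFiniteMeasure_map _ _

/-- **A chordal family carried by simple curves is carried by the chordal carrier**: a.e. curve
class is simple, runs from `a` to `b`, and its trace lies in `D ∪ {a, b}` (it lies in `cl D` and
meets `∂D` only inside `{a, b}`). [folklore] -/
theorem ae_mem_chordalCarrier {P : ChordalFamily} (hP : P.IsChordal)
    (hS : P.IsCarriedBySimpleCurves) (D : DobrushinDomain) :
    ∀ᵐ c ∂P D, c ∈ chordalCarrier D := by
  filter_upwards [(hP D).2, hS D] with c h1 h2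
  obtain ⟨hs, ht, hr⟩ := h1
  obtain ⟨hsim, hfr⟩ := h2
  refine ⟨⟨⟨hsim, hs⟩, ht⟩, fun w hw ↦ ?_⟩
  have hw' := hr hw
  rw [closure_eq_self_union_frontier] at hw'
  rcases hw' with h | h
  · exact Or.inl h
  · exact Or.inr (hfr ⟨hw, h⟩)

/-- **The pull-back law of an avoidance event**: for a `*`-hull `A` and a family carried by the
chordal carrier, `pullbackLaw (K ∩ A = ∅) = P D {trace ∩ φ(A) = ∅}`. [folklore] -/
theorem pullbackLaw_avoid (P : ChordalFamily) (hcar : ∀ᵐ c ∂P D, c ∈ chordalCarrier D)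
    {A : Set ℂ} (hA : IsStarHull A) :
    pullbackLaw P D φ hJarc hC hφ (RestrictionConfig.avoid A) =
      P D (CurveClass.rangeSubset (φ.boundaryExtension '' A)ᶜ) := by
  rw [pullbackLaw_apply P (RestrictionConfig.measurableSet_avoid hA),
    preimage_pullbackConfig_avoid hA.1.subset_closure hA.2]
  refine measure_congr ?_
  filter_upwards [hcar] with c hc
  refine propext ⟨?_, fun h ↦ Or.inl ⟨hc, h⟩⟩
  rintro (⟨-, h⟩ | ⟨h, -⟩)
  · exact h
  · exact absurd hc h

end ChordalFamily

/-! ### Transport: the pull-back law does not depend on the uniformized domain -/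

section Transport

variable {D D' : DobrushinDomain} {φ : ConformalEquiv upperHalfPlaneSet D.carrier}
  {ψ : ConformalEquiv upperHalfPlaneSet D'.carrier}

/-- **The conformal map `ψ ∘ φ⁻¹ : (D; a, b) → (D'; a', b')` between two chordally uniformized
Dobrushin domains has boundary values `a ↦ a'`, `b ↦ b'` and a continuous extension to `ℂ`
intertwining the boundary extensions** (`G ∘ φ̂ = ψ̂` on `ℍ̄`, `G` injective on `cl D`).
Boundary values: Carathéodory (`JordanDomain.tendsto_symm_nhds` / `tendsto_symm_cocompact` for
`φ⁻¹`, hypothesis `hC`). Extension: on `cl D` take `Ψ' ∘ Θ` with `Ψ'` the Carathéodory disc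
extension of `ψ` and `Θ` the inverse of that of `φ` (`JordanDomain.exists_inverse_extension`),
then extend to `ℂ` by the Tietze extension theorem (Mathlib's `ContinuousMap.exists_restrict_eq`
with `Complex.instTietzeExtension`). [cite: PommerenkeBBCM1992, Thm. 2.6] -/
theorem exists_continuousMap_conj (hC : JordanDomain.exists_continuousOn_extension)
    (hφ : D.IsChordalUniformizing φ) (hψ : D'.IsChordalUniformizing ψ) :
    ∃ G : C(ℂ, ℂ), EqOn G (φ.symm.trans ψ) D.carrier ∧
      (φ.symm.trans ψ).HasBoundaryValue (D.pt 0) (D'.pt 0) ∧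
      (φ.symm.trans ψ).HasBoundaryValue (D.pt 1) (D'.pt 1) ∧
      (∀ z, 0 ≤ z.im → G (φ.boundaryExtension z) = ψ.boundaryExtension z) ∧
      G (D.pt 0) = D'.pt 0 ∧ G (D.pt 1) = D'.pt 1 ∧ InjOn G (closure D.carrier) ∧
      MapsTo G D.carrier D'.carrier := by
  -- Carathéodory data
  obtain ⟨Ψ, hΨc, hΨeq, hbij, -⟩ := hC D.toJordanDomain (cayley.symm.trans φ)
  obtain ⟨Ψ', hΨ'c, hΨ'eq, hbij', -⟩ := hC D'.toJordanDomain (cayley.symm.trans ψ)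
  have hinj : InjOn Ψ (closedBall 0 1) := hbij.injOn
  obtain ⟨Θ, hΘc, hΘmaps, hΘΨ, hΨΘ⟩ := JordanDomain.exists_inverse_extension hΨc hbij
  -- the extension on `cl D` and its Tietze extension
  set G₀ : ℂ → ℂ := fun w ↦ Ψ' (Θ w) with hG₀
  have hG₀c : ContinuousOn G₀ (closure D.carrier) := hΨ'c.comp hΘc hΘmaps
  set f : C(closure D.carrier, ℂ) := ⟨(closure D.carrier).restrict G₀, hG₀c.restrict⟩ with hf
  obtain ⟨G, hG⟩ := ContinuousMap.exists_restrict_eq (Y := ℂ) isClosed_closure f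
  have hGeq : ∀ w ∈ closure D.carrier, G w = Ψ' (Θ w) := by
    intro w hw
    have := congrArg (fun g : C(closure D.carrier, ℂ) ↦ g ⟨w, hw⟩) hG
    simpa [hf] using this
  -- values on `D`: `G (φ z) = ψ z`
  have hcay : ∀ {z : ℂ}, 0 ≤ z.im → cayleyFun z ∈ closedBall (0 : ℂ) 1 := fun hz ↦
    mem_closedBall_zero_iff.2 (norm_cayleyFun_le_one hz)
  have hΘφ : ∀ {z : ℂ}, 0 ≤ z.im → Θ (φ.boundaryExtension z) = cayleyFun z := by
    intro z hz
    rw [JordanDomain.boundaryExtension_eq_of_extension φ hΨc hΨeq hz]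
    exact hΘΨ _ (hcay hz)
  have hGbext : ∀ z, 0 ≤ z.im → G (φ.boundaryExtension z) = ψ.boundaryExtension z := by
    intro z hz
    have hmem : φ.boundaryExtension z ∈ closure D.carrier := by
      rw [JordanDomain.boundaryExtension_eq_of_extension φ hΨc hΨeq hz]
      exact hbij.mapsTo (hcay hz)
    rw [hGeq _ hmem, hΘφ hz, JordanDomain.boundaryExtension_eq_of_extension ψ hΨ'c hΨ'eq hz]
  have hGD : ∀ w ∈ D.carrier, G w = ψ (φ.symm w) := by
    intro w hw
    have hz : φ.symm w ∈ upperHalfPlaneSet := φ.symm_mapsTo hw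
    have h1 := hGbext (φ.symm w) (le_of_lt hz)
    rwa [φ.boundaryExtension_eq hz, φ.apply_symm_apply hw, ψ.boundaryExtension_eq hz] at h1
  -- boundary values of `g = ψ ∘ φ⁻¹`
  have hb0 : (φ.symm.trans ψ).HasBoundaryValue (D.pt 0) (D'.pt 0) := by
    have h2 : Tendsto φ.symm (𝓝[D.carrier] (D.pt 0)) (𝓝 ((0 : ℝ) : ℂ)) :=
      JordanDomain.tendsto_symm_nhds φ hΨc hΨeq hinj (x := 0) (by exact_mod_cast hφ.1)
    rw [ofReal_zero] at h2
    have h3 : Tendsto φ.symm (𝓝[D.carrier] (D.pt 0)) (𝓝[upperHalfPlaneSet] 0) :=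
      tendsto_nhdsWithin_iff.2 ⟨h2, eventually_nhdsWithin_of_forall fun w hw ↦ φ.symm_mapsTo hw⟩
    exact hψ.1.comp h3
  have hb1 : (φ.symm.trans ψ).HasBoundaryValue (D.pt 1) (D'.pt 1) := by
    have h2 : Tendsto φ.symm (𝓝[D.carrier] (D.pt 1)) (cocompact ℂ) :=
      JordanDomain.tendsto_symm_cocompact φ hΨc hΨeq hinj hφ.2
    have h3 : Tendsto φ.symm (𝓝[D.carrier] (D.pt 1)) (cocompact ℂ ⊓ 𝓟 upperHalfPlaneSet) :=
      tendsto_inf.2 ⟨h2, tendsto_principal.2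
        (eventually_nhdsWithin_of_forall fun w hw ↦ φ.symm_mapsTo hw)⟩
    exact hψ.2.comp h3
  refine ⟨G, fun w hw ↦ hGD w hw, hb0, hb1, hGbext, ?_, ?_, ?_, ?_⟩
  · have := hGbext 0 (by simp)
    rwa [hφ.boundaryExtension_zero, hψ.boundaryExtension_zero] at this
  · have hb : D.pt 1 = Ψ 1 := (JordanDomain.extension_one_eq φ hΨc hΨeq hφ.2).symm
    have hmem : D.pt 1 ∈ closure D.carrier := frontier_subset_closure (D.pt_mem_frontier 1)
    rw [hGeq _ hmem, hb, hΘΨ 1 (by simp), JordanDomain.extension_one_eq ψ hΨ'c hΨ'eq hψ.2]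
  · intro w₁ hw₁ w₂ hw₂ h
    rw [hGeq _ hw₁, hGeq _ hw₂] at h
    have h' : Θ w₁ = Θ w₂ := hbij'.injOn (hΘmaps hw₁) (hΘmaps hw₂) h
    rw [← hΨΘ w₁ hw₁, ← hΨΘ w₂ hw₂, h']
  · intro w hw
    rw [hGD w hw]
    exact ψ.mapsTo (φ.symm_mapsTo hw)

/-- A continuous map injective on `cl D` pushes chordal simple curve classes of `(D; a, b)` to
chordal simple curve classes of `(D'; a', b')` when it maps `D → D'`, `a ↦ a'`, `b ↦ b'`. [folklore] -/
theorem map_mem_chordalCarrier {G : C(ℂ, ℂ)} (hGinj : InjOn G (closure D.carrier))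
    (hGD : MapsTo G D.carrier D'.carrier) (hGa : G (D.pt 0) = D'.pt 0) (hGb : G (D.pt 1) = D'.pt 1)
    {c : CurveClass ℂ} (hc : c ∈ chordalCarrier D) : CurveClass.map G c ∈ chordalCarrier D' := by
  obtain ⟨γ, rfl, hγ, h0, h1, hr⟩ := exists_rep_of_mem_chordalCarrier hc
  have hcl : Set.range γ ⊆ closure D.carrier := by
    rintro _ ⟨t, rfl⟩
    rcases hr ⟨t, rfl⟩ with h | h
    · exact subset_closure h
    · rcases h with h | h <;> rw [h] <;> exact frontier_subset_closure (D.pt_mem_frontier _)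
  rw [CurveClass.map_mk]
  refine ⟨⟨⟨CurveClass.mk_mem_simple ?_, ?_⟩, ?_⟩, ?_⟩
  · intro s t hst
    exact hγ (hGinj (hcl ⟨s, rfl⟩) (hcl ⟨t, rfl⟩) hst)
  · show G (γ 0) = D'.pt 0
    rw [h0, hGa]
  · show G (γ 1) = D'.pt 1
    rw [h1, hGb]
  · show Set.range (fun t ↦ G (γ t)) ⊆ D'.carrier ∪ {D'.pt 0, D'.pt 1}
    rintro _ ⟨t, rfl⟩
    show G (γ t) ∈ D'.carrier ∪ {D'.pt 0, D'.pt 1}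
    rcases hr ⟨t, rfl⟩ with h | h
    · exact Or.inl (hGD h)
    · rcases h with h | h
      · rw [h, hGa]; exact Or.inr (Or.inl rfl)
      · rw [mem_singleton_iff.1 h, hGb]; exact Or.inr (Or.inr rfl)

/-- The conjugating map intertwines the pulled-back traces: `ψ⁻¹ (G(trace) ∩ D') = φ⁻¹ (trace ∩ D)`. [folklore] -/
theorem pullbackTrace_map_eq {G : C(ℂ, ℂ)} (hGg : EqOn G (φ.symm.trans ψ) D.carrier)
    (hGa : G (D.pt 0) = D'.pt 0) (hGb : G (D.pt 1) = D'.pt 1)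
    {c : CurveClass ℂ} (hc : c ∈ chordalCarrier D) :
    ψ.pullbackTrace (CurveClass.map G c) = φ.pullbackTrace c := by
  have hr : c.range ⊆ D.carrier ∪ {D.pt 0, D.pt 1} := hc.2
  rw [ConformalEquiv.pullbackTrace, ConformalEquiv.pullbackTrace, CurveClass.range_map]
  ext z
  constructor
  · rintro ⟨_, ⟨⟨w, hw, rfl⟩, hwD'⟩, rfl⟩
    have hwD : w ∈ D.carrier := by
      rcases hr hw with h | h
      · exact h
      · exfalso
        rcases h with h | h
        · rw [h, hGa] at hwD'; exact D'.pt_notMem_carrier 0 hwD'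
        · rw [h, hGb] at hwD'; exact D'.pt_notMem_carrier 1 hwD'
    refine ⟨w, ⟨hw, hwD⟩, ?_⟩
    rw [hGg hwD, ConformalEquiv.trans_apply, ψ.symm_apply_apply (φ.symm_mapsTo hwD)]
  · rintro ⟨w, ⟨hw, hwD⟩, rfl⟩
    refine ⟨G w, ⟨⟨w, hw, rfl⟩, ?_⟩, ?_⟩
    · rw [hGg hwD]; exact ψ.mapsTo (φ.symm_mapsTo hwD)
    · rw [hGg hwD, ConformalEquiv.trans_apply, ψ.symm_apply_apply (φ.symm_mapsTo hwD)]

/-- **Transport of the pull-back law** ([LSW] Prop. 3.3 (1) "`Γ`-invariant" and §1: the law in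
another domain is the conformal image): for a conformally covariant chordal family carried by
chordal simple curves, the pull-back law through `(D', ψ)` equals that through `(D, φ)` — apply
covariance to `g = ψ ∘ φ⁻¹` and its continuous extension `G` (`exists_continuousMap_conj`), and
note `ψ⁻¹ ∘ G = φ⁻¹` on traces. [cite: LawlerSchrammWerner2003Restriction, Prop. 3.3 (1) (p. 10), transposed] -/
theorem ChordalFamily.pullbackLaw_eq_of_covariant {P : ChordalFamily} (hcov : P.IsConformallyCovariant)
    (hcar : ∀ D : DobrushinDomain, ∀ᵐ c ∂P D, c ∈ chordalCarrier D)
    (hJarc : Literature.Topology.PlaneTopology.JordanArcSeparation) (hC : JordanDomain.exists_continuousOn_extension)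
    (hφ : D.IsChordalUniformizing φ) (hψ : D'.IsChordalUniformizing ψ) :
    ChordalFamily.pullbackLaw P D' ψ hJarc hC hψ = ChordalFamily.pullbackLaw P D φ hJarc hC hφ := by
  obtain ⟨G, hGg, hb0, hb1, -, hGa, hGb, hGinj, hGD⟩ := exists_continuousMap_conj hC hφ hψ
  rw [ChordalFamily.pullbackLaw, ChordalFamily.pullbackLaw, hcov D D' (φ.symm.trans ψ) G hb0 hb1 hGg,
    Measure.map_map measurable_pullbackConfig (CurveClass.measurable_map G)]
  refine Measure.map_congr ?_
  filter_upwards [hcar D] with c hc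
  have hc' : CurveClass.map G c ∈ chordalCarrier D' := map_mem_chordalCarrier hGinj hGD hGa hGb hc
  apply Subtype.ext
  rw [Function.comp_apply, coe_pullbackConfig hc', coe_pullbackConfig hc,
    pullbackTrace_map_eq hGg hGa hGb hc]

end Transport

/-! ### Scale invariance of the pull-back law -/

section Scale

/-- Positive dilations preserve the open upper half-plane. [folklore] -/
theorem smul_upperHalfPlaneSet {r : ℝ} (hr : 0 < r) : r • upperHalfPlaneSet = upperHalfPlaneSet := by
  ext z
  rw [Set.mem_smul_set_iff_inv_smul_mem₀ hr.ne']
  simp only [upperHalfPlaneSet, mem_setOf_eq, Complex.real_smul, Complex.mul_im, Complex.ofReal_re,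
    Complex.ofReal_im, zero_mul, add_zero]
  constructor
  · intro h
    by_contra hle
    push Not at hle
    have : r⁻¹ * z.im ≤ 0 := mul_nonpos_of_nonneg_of_nonpos (inv_pos.2 hr).le hle
    linarith
  · intro h
    exact mul_pos (inv_pos.2 hr) h

/-- **`𝒬*` is invariant under positive dilations** (`A ∈ 𝒬*`, `r > 0` ⇒ `r A ∈ 𝒬*`; [LSW]
proof of Prop. 3.3, p. 11: "`Φ_{λA}'(0) = Φ_A'(0)` for `A ∈ 𝒬*`, `λ > 0`" presupposes this).
[cite: LawlerSchrammWerner2003Restriction, Prop. 3.3 proof (p. 11)] -/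
theorem IsStarHull.smul {A : Set ℂ} (hA : IsStarHull A) {r : ℝ} (hr : 0 < r) : IsStarHull (r • A) := by
  have hr0 : r ≠ 0 := hr.ne'
  refine ⟨⟨hA.1.1.smul₀ r, ?_, ?_⟩, ?_⟩
  · rw [← smul_upperHalfPlaneSet hr, ← Set.smul_set_inter₀ hr0, closure_smul₀' hr0, hA.1.2.1]
  · -- `ℍ ∖ rA ≅ ℍ ∖ A` by the dilation
    have h1 : MapsTo (ConformalEquiv.smulUpperHalfPlane r hr) (upperHalfPlaneSet \ A)
        (upperHalfPlaneSet \ r • A) := by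
      rintro z ⟨hz, hzA⟩
      refine ⟨(ConformalEquiv.smulUpperHalfPlane r hr).mapsTo hz, fun h ↦ hzA ?_⟩
      rw [ConformalEquiv.smulUpperHalfPlane_apply] at h
      rwa [Set.smul_mem_smul_set_iff₀ hr0] at h
    have h2 : MapsTo (ConformalEquiv.smulUpperHalfPlane r hr).symm (upperHalfPlaneSet \ r • A)
        (upperHalfPlaneSet \ A) := by
      rintro w ⟨hw, hwA⟩
      refine ⟨(ConformalEquiv.smulUpperHalfPlane r hr).symm_mapsTo hw, fun h ↦ hwA ?_⟩
      rw [ConformalEquiv.smulUpperHalfPlane_symm_apply] at h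
      rwa [← Set.mem_smul_set_iff_inv_smul_mem₀ hr0] at h
    exact ((ConformalEquiv.smulUpperHalfPlane r hr).restr _ _ sdiff_subset sdiff_subset h1
      h2).isSimplyConnected_iff.1 hA.1.2.2
  · rw [Set.zero_mem_smul_set_iff hr0]
    exact hA.2

variable {D : DobrushinDomain} {φ : ConformalEquiv upperHalfPlaneSet D.carrier}

/-- The pulled-back trace through `φ ∘ (r ·)` is `r⁻¹` times that through `φ`. [folklore] -/
theorem ConformalEquiv.pullbackTrace_smul_trans {r : ℝ} (hr : 0 < r) (c : CurveClass ℂ) :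
    ((ConformalEquiv.smulUpperHalfPlane r hr).trans φ).pullbackTrace c = r⁻¹ • φ.pullbackTrace c := by
  rw [ConformalEquiv.pullbackTrace, ConformalEquiv.pullbackTrace, ← image_smul, image_image]
  rfl

/-- Avoidance of `A` by `r⁻¹ T` is avoidance of `r A` by `T`. [folklore] -/
theorem disjoint_inv_smul_set_iff {r : ℝ} (hr : r ≠ 0) {T A : Set ℂ} :
    Disjoint (r⁻¹ • T) A ↔ Disjoint T (r • A) := by
  rw [Set.disjoint_left, Set.disjoint_left]
  constructor
  · intro h x hxT hxA
    rw [Set.mem_smul_set_iff_inv_smul_mem₀ hr] at hxA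
    exact h (Set.smul_mem_smul_set hxT) hxA
  · rintro h _ ⟨x, hxT, rfl⟩ hxA
    refine h hxT ?_
    rw [Set.mem_smul_set_iff_inv_smul_mem₀ hr]
    exact hxA

/-- **Scale invariance of the pull-back law** ([LSW] Prop. 3.3 (1): "`P` is `Γ`-invariant",
`Γ` the dilations `z ↦ λz`): for a conformally covariant chordal family carried by chordal
simple curves, `P̃ {K ∩ rA = ∅} = P̃ {K ∩ A = ∅}` — the pull-back through `φ ∘ (r ·)`, again a
chordal uniformizing map, is the same law (`pullbackLaw_eq_of_covariant`) and its configuration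
is `r⁻¹ K`. [cite: LawlerSchrammWerner2003Restriction, Prop. 3.3 (1) (p. 10), transposed] -/
theorem ChordalFamily.isScaleInvariant_pullbackLaw {P : ChordalFamily} (hcov : P.IsConformallyCovariant)
    (hcar : ∀ D : DobrushinDomain, ∀ᵐ c ∂P D, c ∈ chordalCarrier D)
    (hJarc : Literature.Topology.PlaneTopology.JordanArcSeparation) (hC : JordanDomain.exists_continuousOn_extension)
    (hφ : D.IsChordalUniformizing φ) :
    RestrictionConfig.IsScaleInvariant (ChordalFamily.pullbackLaw P D φ hJarc hC hφ) := by
  intro A hA r hr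
  set ψ := (ConformalEquiv.smulUpperHalfPlane r hr).trans φ with hψdef
  have hψ : D.IsChordalUniformizing ψ := hφ.smul_trans r hr
  have key := ChordalFamily.pullbackLaw_eq_of_covariant hcov hcar hJarc hC hφ hψ
  calc ChordalFamily.pullbackLaw P D φ hJarc hC hφ (RestrictionConfig.avoid (r • A))
      = P D (pullbackConfig hJarc hC hφ ⁻¹' RestrictionConfig.avoid (r • A)) :=
        ChordalFamily.pullbackLaw_apply _ (RestrictionConfig.measurableSet_avoid (hA.smul hr))
    _ = P D (pullbackConfig hJarc hC hψ ⁻¹' RestrictionConfig.avoid A) := by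
        refine measure_congr ?_
        filter_upwards [hcar D] with c hc
        refine propext ?_
        change pullbackConfig hJarc hC hφ c ∈ RestrictionConfig.avoid (r • A) ↔
          pullbackConfig hJarc hC hψ c ∈ RestrictionConfig.avoid A
        rw [pullbackConfig_mem_avoid_iff hc, pullbackConfig_mem_avoid_iff hc, hψdef,
          ConformalEquiv.pullbackTrace_smul_trans hr, disjoint_inv_smul_set_iff hr.ne']
    _ = ChordalFamily.pullbackLaw P D ψ hJarc hC hψ (RestrictionConfig.avoid A) :=
        (ChordalFamily.pullbackLaw_apply _ (RestrictionConfig.measurableSet_avoid hA)).symm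
    _ = ChordalFamily.pullbackLaw P D φ hJarc hC hφ (RestrictionConfig.avoid A) := by rw [key]

end Scale

/-! ### Restriction over a hull subdomain gives multiplicativity at the pulled-back hull -/

section Multiplicative

variable {D D' : DobrushinDomain} {φ : ConformalEquiv upperHalfPlaneSet D.carrier}

/-- For `z ∈ ℍ`: `z ∉ A = closure (ℍ ∖ φ⁻¹ D')` iff `φ z ∈ D'`. [folklore] -/
theorem notMem_pullbackHull_iff {z : ℂ} (hz : z ∈ upperHalfPlaneSet) :
    z ∉ φ.pullbackHull D' ↔ φ z ∈ D'.carrier := by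
  constructor
  · intro h
    have : z ∈ upperHalfPlaneSet \ φ.pullbackHull D' := ⟨hz, h⟩
    rw [ConformalEquiv.diff_pullbackHull] at this
    exact this.2
  · intro h hzA
    have : z ∈ upperHalfPlaneSet \ φ.pullbackHull D' := by
      rw [ConformalEquiv.diff_pullbackHull]; exact ⟨hz, h⟩
    exact this.2 hzA

/-- **Avoiding the pulled-back hull is being a chordal curve of the subdomain**: for `c` in the
chordal carrier of `(D; a, b)` and a hull subdomain `D'`, `φ⁻¹(trace ∩ D) ∩ A = ∅` iff
`c ∈ chordalCarrier D'`. [folklore] -/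
theorem disjoint_pullbackTrace_pullbackHull_iff (hD' : D.IsHullSubdomain D') {c : CurveClass ℂ}
    (hc : c ∈ chordalCarrier D) :
    Disjoint (φ.pullbackTrace c) (φ.pullbackHull D') ↔ c ∈ chordalCarrier D' := by
  rw [ConformalEquiv.disjoint_pullbackTrace_iff]
  have hr : c.range ⊆ D.carrier ∪ {D.pt 0, D.pt 1} := hc.2
  constructor
  · intro h
    refine ⟨⟨⟨hc.1.1.1, ?_⟩, ?_⟩, fun w hw ↦ ?_⟩
    · show c.source = D'.pt 0
      rw [hD'.pt_zero_eq]; exact hc.1.1.2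
    · show c.target = D'.pt 1
      rw [hD'.pt_one_eq]; exact hc.1.2
    · rcases hr hw with hwD | hab
      · have h1 := (notMem_pullbackHull_iff (φ.symm_mapsTo hwD)).1 (h w ⟨hw, hwD⟩)
        rw [φ.apply_symm_apply hwD] at h1
        exact Or.inl h1
      · rw [hD'.pt_zero_eq, hD'.pt_one_eq]
        exact Or.inr hab
  · rintro hc' w ⟨hw, hwD⟩
    have hr' : c.range ⊆ D'.carrier ∪ {D'.pt 0, D'.pt 1} := hc'.2
    refine (notMem_pullbackHull_iff (φ.symm_mapsTo hwD)).2 ?_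
    rw [φ.apply_symm_apply hwD]
    rcases hr' hw with h | h
    · exact h
    · exfalso
      rw [hD'.pt_zero_eq, hD'.pt_one_eq] at h
      rcases h with h | h
      · exact D.pt_notMem_carrier 0 (h ▸ hwD)
      · exact D.pt_notMem_carrier 1 ((mem_singleton_iff.1 h) ▸ hwD)

/-- The chordal carrier of a hull subdomain lies in that of the domain. [folklore] -/
theorem chordalCarrier_mono (hD' : D.IsHullSubdomain D') : chordalCarrier D' ⊆ chordalCarrier D := by
  intro c hc
  have hr : c.range ⊆ D'.carrier ∪ {D'.pt 0, D'.pt 1} := hc.2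
  refine ⟨⟨⟨hc.1.1.1, ?_⟩, ?_⟩, fun w hw ↦ ?_⟩
  · show c.source = D.pt 0
    rw [← hD'.pt_zero_eq]; exact hc.1.1.2
  · show c.target = D.pt 1
    rw [← hD'.pt_one_eq]; exact hc.1.2
  · rcases hr hw with h | h
    · exact Or.inl (hD'.carrier_subset h)
    · rw [hD'.pt_zero_eq, hD'.pt_one_eq] at h
      exact Or.inr h

/-- For a chordal curve of the hull subdomain, the points of the trace in `D` are in `D'`. [folklore] -/
theorem range_inter_carrier_eq_of_subdomain (hD' : D.IsHullSubdomain D') {c : CurveClass ℂ}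
    (hc : c ∈ chordalCarrier D') : c.range ∩ D.carrier = c.range ∩ D'.carrier := by
  have hr : c.range ⊆ D'.carrier ∪ {D'.pt 0, D'.pt 1} := hc.2
  refine Subset.antisymm ?_ (inter_subset_inter_right _ hD'.carrier_subset)
  rintro w ⟨hw, hwD⟩
  refine ⟨hw, ?_⟩
  rcases hr hw with h | h
  · exact h
  · exfalso
    rw [hD'.pt_zero_eq, hD'.pt_one_eq] at h
    rcases h with h | h
    · exact D.pt_notMem_carrier 0 (h ▸ hwD)
    · exact D.pt_notMem_carrier 1 ((mem_singleton_iff.1 h) ▸ hwD)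

/-- **The pulled-back trace through `ψ = φ ∘ Φ_A⁻¹` is `Φ_A` of the pulled-back trace through
`φ`** (for chordal curves of the hull subdomain). [folklore] -/
theorem pullbackTrace_pullback_eq (hD' : D.IsHullSubdomain D')
    {Φ : ConformalEquiv (upperHalfPlaneSet \ φ.pullbackHull D') upperHalfPlaneSet}
    {c : CurveClass ℂ} (hc : c ∈ chordalCarrier D') :
    (Φ.symm.trans (φ.restrHull D' hD'.carrier_subset)).pullbackTrace c = Φ '' φ.pullbackTrace c := by
  rw [ConformalEquiv.pullbackTrace, ConformalEquiv.pullbackTrace, image_image,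
    range_inter_carrier_eq_of_subdomain hD' hc]
  rfl

/-- On a trace avoiding `A'`, avoiding `A · A'` is `Φ_{A'}`(trace) avoiding `A`. [folklore] -/
theorem disjoint_hullProduct_iff_of_disjoint {A : Set ℂ} (hA : IsClosed A)
    {Φ : ConformalEquiv (upperHalfPlaneSet \ φ.pullbackHull D') upperHalfPlaneSet}
    {T : Set ℂ} (hT : T ⊆ upperHalfPlaneSet) (hdisj : Disjoint T (φ.pullbackHull D')) :
    Disjoint T (hullProduct A (φ.pullbackHull D') Φ) ↔ Disjoint (Φ '' T) A := by
  rw [Set.disjoint_left, Set.disjoint_left]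
  constructor
  · rintro h _ ⟨z, hz, rfl⟩ hzA
    exact h hz (by
      by_contra hzB
      exact ((notMem_hullProduct_iff hA ConformalEquiv.isClosed_pullbackHull (hT hz)).1 hzB).2 hzA)
  · intro h z hz hzB
    have h1 := (notMem_hullProduct_iff hA ConformalEquiv.isClosed_pullbackHull (hT hz)).2
      ⟨Set.disjoint_left.1 hdisj hz, h ⟨z, hz, rfl⟩⟩
    exact h1 hzB

/-- A trace meeting `A'` meets `A · A'`. [folklore] -/
theorem not_disjoint_hullProduct_of_not_disjoint {A : Set ℂ}
    {Φ : ConformalEquiv (upperHalfPlaneSet \ φ.pullbackHull D') upperHalfPlaneSet}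
    {T : Set ℂ} (hT : T ⊆ upperHalfPlaneSet) (h : ¬ Disjoint T (φ.pullbackHull D')) :
    ¬ Disjoint T (hullProduct A (φ.pullbackHull D') Φ) := by
  rw [Set.not_disjoint_iff] at h ⊢
  obtain ⟨z, hzT, hzA'⟩ := h
  exact ⟨z, hzT, hullProductCore_subset_hullProduct (Or.inl ⟨hzA', hT hzT⟩)⟩

/-- The complement of "the trace misses every boundary piece of `D'`" is measurable. [folklore] -/
theorem measurableSet_touch (D' : DobrushinDomain) :
    MeasurableSet (⋂ k, CurveClass.rangeSubset (frontierPiece D' k)ᶜ : Set (CurveClass ℂ))ᶜ :=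
  (MeasurableSet.iInter fun k ↦
    CurveClass.measurableSet_rangeSubset_compl (isClosed_frontierPiece k)).compl

/-- **Under `P D`, a curve lying in `cl D'` is a.s. a chordal curve of `D'`** (the family being
carried by simple curves touching `∂D'` only at `a, b`, and satisfying restriction over `D'`):
the event "in `cl D'` but touching `∂D' ∖ {a, b}`" has `P D`-mass `P D' (touch) · P D (cl D') = 0`.
[folklore] -/
theorem ChordalFamily.ae_mem_chordalCarrier_of_rangeSubset {P : ChordalFamily} (hP : P.IsChordal)
    (hres : P.IsHullRestriction) (hS : P.IsCarriedBySimpleCurves) (hD' : D.IsHullSubdomain D') :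
    ∀ᵐ c ∂P D, c ∈ CurveClass.rangeSubset (closure D'.carrier) → c ∈ chordalCarrier D' := by
  set W : Set (CurveClass ℂ) := (⋂ k, CurveClass.rangeSubset (frontierPiece D' k)ᶜ)ᶜ with hW
  set V : Set (CurveClass ℂ) := CurveClass.rangeSubset (closure D'.carrier) with hV
  have hWm : MeasurableSet W := measurableSet_touch D'
  -- `P D' (W) = 0`
  have hW0 : P D' W = 0 := by
    refine measure_eq_zero_iff_ae_notMem.2 ?_
    filter_upwards [ChordalFamily.ae_mem_chordalCarrier hP hS D'] with c hc hcW
    have h1 : c ∈ {c : CurveClass ℂ | c.range ⊆ D'.carrier ∪ {D'.pt 0, D'.pt 1}} := hc.2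
    rw [setOf_range_subset_eq] at h1
    exact hcW h1.2
  -- restriction: `P D (W ∩ V) = P D' W · P D V = 0`
  have hWV : P D (W ∩ V) = 0 := by
    rw [← hres D D' hD' W hWm, hW0, zero_mul]
  filter_upwards [measure_eq_zero_iff_ae_notMem.1 hWV, ChordalFamily.ae_mem_chordalCarrier hP hS D]
    with c hcWV hc hcV
  have hW' : c ∉ W := fun h ↦ hcWV ⟨h, hcV⟩
  rw [hW, mem_compl_iff, not_not] at hW'
  have h1 : c ∈ {c : CurveClass ℂ | c.range ⊆ D'.carrier ∪ {D'.pt 0, D'.pt 1}} := by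
    rw [setOf_range_subset_eq]; exact ⟨hcV, hW'⟩
  refine ⟨⟨⟨hc.1.1.1, ?_⟩, ?_⟩, h1⟩
  · show c.source = D'.pt 0
    rw [hD'.pt_zero_eq]; exact hc.1.1.2
  · show c.target = D'.pt 1
    rw [hD'.pt_one_eq]; exact hc.1.2

/-- **Two-sided restriction over a hull subdomain `D'` makes the pull-back law multiplicative
at the pulled-back hull `A' = closure (ℍ ∖ φ⁻¹ D')`** ([LSW] §2 p. 9: "if `μ` is covariant under
`Γ` then `F_{φ∘ψ} = F_φ F_ψ`", Prop. 3.3 (1); transposed): for every `A ∈ 𝒬*`,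
`P̃ {K ∩ (A · A') = ∅} = P̃ {K ∩ A = ∅} · P̃ {K ∩ A' = ∅}`. Proof: on the chordal carrier,
`{φ⁻¹(trace) ∩ (A·A') = ∅} = {trace ⊆ D' ∪ {a,b}} ∩ {ψ⁻¹(trace) ∩ A = ∅}` with
`ψ = φ ∘ Φ_{A'}⁻¹` the chordal uniformizing map of `D'` (`IsChordalUniformizing.pullback`); the
restriction identity with `T = {ψ⁻¹(trace) ∩ A = ∅}` gives `P D' (T) · P D {trace ⊆ cl D'}`;
`P D' (T) = P̃ {K ∩ A = ∅}` by transport (`pullbackLaw_eq_of_covariant`) and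
`P D {trace ⊆ cl D'} = P̃ {K ∩ A' = ∅}` because touching `∂D'` off `a, b` is `P D`-null
(`ae_mem_chordalCarrier_of_rangeSubset`).
[cite: LawlerSchrammWerner2003Restriction, §2 p. 9 (covariance, F homomorphism) and Prop. 3.3 (1) (p. 10), transposed] -/
theorem ChordalFamily.pullbackLaw_avoid_hullProduct {P : ChordalFamily} (hP : P.IsChordal)
    (hcov : P.IsConformallyCovariant) (hres : P.IsHullRestriction) (hS : P.IsCarriedBySimpleCurves)
    (hJarc : Literature.Topology.PlaneTopology.JordanArcSeparation) (hC : JordanDomain.exists_continuousOn_extension)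
    (hsc : ∀ D : JordanDomain, D.isSimplyConnected)
    (hRM : ∀ {U : Set ℂ}, exists_conformalEquiv_ball (U := U))
    (hφ : D.IsChordalUniformizing φ) (hD' : D.IsHullSubdomain D')
    {Φ : ConformalEquiv (upperHalfPlaneSet \ φ.pullbackHull D') upperHalfPlaneSet}
    (hΦ : IsRestrictionMap (φ.pullbackHull D') Φ) {A : Set ℂ} (hA : IsStarHull A) :
    ChordalFamily.pullbackLaw P D φ hJarc hC hφ
        (RestrictionConfig.avoid (hullProduct A (φ.pullbackHull D') Φ)) =
      ChordalFamily.pullbackLaw P D φ hJarc hC hφ (RestrictionConfig.avoid A) *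
        ChordalFamily.pullbackLaw P D φ hJarc hC hφ (RestrictionConfig.avoid (φ.pullbackHull D')) := by
  have hcar : ∀ D : DobrushinDomain, ∀ᵐ c ∂P D, c ∈ chordalCarrier D :=
    ChordalFamily.ae_mem_chordalCarrier hP hS
  have hA' : IsStarHull (φ.pullbackHull D') := IsStarHull.pullbackHull hsc hφ hD'
  have hAc : IsClosed A := hA.isBoundedHull.isClosed
  have hB : IsStarHull (hullProduct A (φ.pullbackHull D') Φ) := hA.hullProduct hA' hΦ
  set ψ : ConformalEquiv upperHalfPlaneSet D'.carrier :=
    Φ.symm.trans (φ.restrHull D' hD'.carrier_subset) with hψdef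
  have hψ : D'.IsChordalUniformizing ψ :=
    MarkedDomain.IsChordalUniformizing.pullback hsc hRM hC hφ hD' hΦ
  set T : Set (CurveClass ℂ) := pullbackConfig hJarc hC hψ ⁻¹' RestrictionConfig.avoid A with hTdef
  have hTm : MeasurableSet T := measurable_pullbackConfig (RestrictionConfig.measurableSet_avoid hA)
  set V : Set (CurveClass ℂ) := CurveClass.rangeSubset (closure D'.carrier) with hVdef
  have hVm : MeasurableSet V := CurveClass.measurableSet_rangeSubset isClosed_closure
  have hC'V : chordalCarrier D' ⊆ V := by
    intro c hc w hw
    have hr : c.range ⊆ D'.carrier ∪ {D'.pt 0, D'.pt 1} := hc.2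
    rcases hr hw with h | h
    · exact subset_closure h
    · rcases h with h | h <;> rw [h] <;> exact frontier_subset_closure (D'.pt_mem_frontier _)
  have hVC' := ChordalFamily.ae_mem_chordalCarrier_of_rangeSubset hP hres hS hD'
  -- Step 1: the left-hand event is `chordalCarrier D' ∩ T` a.e.
  have hL : ChordalFamily.pullbackLaw P D φ hJarc hC hφ
      (RestrictionConfig.avoid (hullProduct A (φ.pullbackHull D') Φ)) = P D (T ∩ V) := by
    rw [ChordalFamily.pullbackLaw_apply _ (RestrictionConfig.measurableSet_avoid hB)]
    refine measure_congr ?_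
    filter_upwards [hcar D, hVC'] with c hc hcV
    refine propext ?_
    change pullbackConfig hJarc hC hφ c ∈
        RestrictionConfig.avoid (hullProduct A (φ.pullbackHull D') Φ) ↔ c ∈ T ∩ V
    rw [pullbackConfig_mem_avoid_iff hc]
    constructor
    · intro h
      have hdisj : Disjoint (φ.pullbackTrace c) (φ.pullbackHull D') := by
        by_contra h'
        exact not_disjoint_hullProduct_of_not_disjoint (ConformalEquiv.pullbackTrace_subset c) h' h
      have hc' : c ∈ chordalCarrier D' := (disjoint_pullbackTrace_pullbackHull_iff hD' hc).1 hdisj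
      refine ⟨?_, hC'V hc'⟩
      change pullbackConfig hJarc hC hψ c ∈ RestrictionConfig.avoid A
      rw [pullbackConfig_mem_avoid_iff hc', hψdef, pullbackTrace_pullback_eq hD' hc']
      exact (disjoint_hullProduct_iff_of_disjoint hAc (ConformalEquiv.pullbackTrace_subset c)
        hdisj).1 h
    · rintro ⟨hT, hV⟩
      have hc' : c ∈ chordalCarrier D' := hcV hV
      have hdisj : Disjoint (φ.pullbackTrace c) (φ.pullbackHull D') :=
        (disjoint_pullbackTrace_pullbackHull_iff hD' hc).2 hc'
      change pullbackConfig hJarc hC hψ c ∈ RestrictionConfig.avoid A at hT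
      rw [pullbackConfig_mem_avoid_iff hc', hψdef, pullbackTrace_pullback_eq hD' hc'] at hT
      exact (disjoint_hullProduct_iff_of_disjoint hAc (ConformalEquiv.pullbackTrace_subset c)
        hdisj).2 hT
  -- Step 2: restriction
  have hR : P D (T ∩ V) = P D' T * P D V := (hres D D' hD' T hTm).symm
  -- Step 3: `P D' T = P̃ (avoid A)` by transport
  have h3 : P D' T = ChordalFamily.pullbackLaw P D φ hJarc hC hφ (RestrictionConfig.avoid A) := by
    rw [← ChordalFamily.pullbackLaw_eq_of_covariant hcov hcar hJarc hC hφ hψ,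
      ChordalFamily.pullbackLaw_apply _ (RestrictionConfig.measurableSet_avoid hA)]
  -- Step 4: `P D V = P̃ (avoid A')`
  have h4 : P D V = ChordalFamily.pullbackLaw P D φ hJarc hC hφ
      (RestrictionConfig.avoid (φ.pullbackHull D')) := by
    rw [ChordalFamily.pullbackLaw_apply _ (RestrictionConfig.measurableSet_avoid hA')]
    refine measure_congr ?_
    filter_upwards [hcar D, hVC'] with c hc hcV
    refine propext ⟨fun hV ↦ ?_, fun h ↦ ?_⟩
    · change pullbackConfig hJarc hC hφ c ∈ RestrictionConfig.avoid (φ.pullbackHull D')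
      rw [pullbackConfig_mem_avoid_iff hc, disjoint_pullbackTrace_pullbackHull_iff hD' hc]
      exact hcV hV
    · change pullbackConfig hJarc hC hφ c ∈ RestrictionConfig.avoid (φ.pullbackHull D') at h
      rw [pullbackConfig_mem_avoid_iff hc, disjoint_pullbackTrace_pullbackHull_iff hD' hc] at h
      exact hC'V h
  rw [hL, hR, h3, h4]

end Multiplicative

end Literature.Probability.RandomPlanarGeometry

end
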